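import Literature.IUT.HodgeArakelov.ThetaSettingHextGeometricCoreAtModelTate
import Literature.AnabelianGeometry.AbsoluteAnabelian.AbsTopI.CharOpenBasis
import Literature.AnabelianGeometry.EtaleTheta.Discharge.Sec2PiCHatSlimModelKrull
import HarnessLib

/-!
# The extension property `hextΔ` at the stage-2 Tate model, F̂₂ FORM: an automorphism-extension problem
# `Û ≤ F̂₂` in the free profinite group of rank 2, plus the displayed conjunct «`γ` preserves `Δ^tp_{X̲̲}`» (proof-only)

S. Mochizuki, *The étale theta function and its Frobenioid-theoretic manifestations* [EtTh], Publ. RIMS **45** (2009)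
(refereed), §2, Prop. 2.4 p. 38; §1 p. 12 («`Π_X := (Π^tp_X)^∧`», «`Δ_X` … a profinite free group on 2 generators», the surjection
`Π^tp_X ↠ Z`); Def. 2.5 (i) p. 39 (`X̲̲`). [cite: MochizukiEtTh2009, Prop 2.4 p.38]  [SemiAnbd] §6 p. 69 («THE profinite completion»).

Cell `abc-iut`, seat abc-iut-L6-t13 (gen 13; K-L6 row «HEXT-DECIDE@modelχq», sub-row «HEXT-GEOMETRIC-CORE» file 2/2, abc-iut-L6-lead
§F v1.19eh (B) GO: «(C) with the conjunct ‹γ(inl dUU l) ⊆ inl Γ› EXPLICIT (NOT a tree theorem — keep it a displayed conjunct)»).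
PROOF-ONLY companion of file 1 `ThetaSettingHextGeometricCoreAtModelTate` (★ `hext_at_iff_exists_gfpAut_extends`), of abc-iut-w5-d169's
reduction p497819/p498683, abc-iut-L2-t1's `SettingModel2Curve` (`Gfp`, `eHat`, `gfpFst`, `isProfiniteCompletion_gfpFst`), the tree's
`zh_eq_one_of_pow_eq_one` (`Ẑ` torsion-free, `Discharge/Sec2PiCHatSlimModelKrull`) and `IsProfiniteCompletion.exists_continuousMulEquiv_extending`
(`AbsTopI/CharOpenBasis`): NO definition, NO instance, NO new named fact; every input is consumed BY NAME.

WHAT THIS FILE PROVES (numbers, not adjectives; EVERY prime `p`, EVERY `i j`, EVERY `X̲̲`-choice of the displayed shape, EVERY `l`).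
* §1 `exists_eHat_apply_gfpFst_eq_iotaZ` — **DEGREE BOOKKEEPING IS AUTOMATIC**: if an endomorphism `Ψ` of `F̂₂` maps `pr₁(dUU l)` into
  `pr₁(Γ)`, then it maps ALL of `pr₁(Γ) = ê⁻¹(ι ℤ)` into `pr₁(Γ)`: for `g ∈ Γ`, `g^M ∈ Ker ĥ_l ≤ dUU l` (`M` = the index of the normal
  core, `Subgroup.pow_index_mem`), so `y := ê(Ψ(pr₁ g))` has `y^M = ι(k)`; reading level `M` gives `M ∣ k`, and torsion-freeness gives
  `y = ι(k/M)` (`Ẑ` torsion-free, tree).  No density, no parity, no `N` odd.  `exists_monoidHom_gfpFst_comp` — hence `Ψ` LIFTS to an endomorphism `Φ₀` of `Γ` with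
  `pr₁ ∘ Φ₀ = Ψ ∘ pr₁` (`pr₁` is injective).
* §2 ★ `hext_at_iff_exists_f2hatAut` — **THE F̂₂ FORM**: `hextΔ(γ) ⟺ (D) ∧ (E)` where
    (D) «`γ` carries `inl (dUU l) = Δ^tp_{X̲̲}` ONTO itself» — displayed as the two clauses `(γ (inl d)).right = 1`, `(γ⁻¹ (inl d)).right = 1`
        for `d ∈ dUU l` (NOT a theorem of the tree; kept EXPLICIT as ruled), and
    (E) «the completed geometric part extends to `Aut_top(F̂₂)`»: `∃ Φ̂ : F̂₂ ≃ₜ* F̂₂, Φ̂ (pr₁ d) = pr₁ ((γ (inl d)).left)` for `d ∈ dUU l`.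
  (⇒) `Φ̂ :=` the extension of file 1's / p498683's `Φ : Γ ≃ₜ* Γ` along the profinite completion `pr₁ : Γ → F̂₂`; (⇐) §1 lifts `Φ̂` and
  `Φ̂⁻¹` to mutually inverse endomorphisms of `Γ`, continuous because they agree with the (continuous) geometric parts of `γ^{±1}` on the
  OPEN subgroup `dUU l` (§1); then file 1's `hext_at_iff_exists_gfpAut_extends`.  `hext_at_iff_exists_f2hatAut_of_eq` = the same at the
  carrier of record `Huuχq p i j l hl`.
CONSEQUENCE FOR THE K-L6 CELL (honest words): «`hextΔ` UNDECIDED-AT-MODEL» is now LITERALLY: for every bi-continuous automorphism `γ` of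
`dUU l ⋊ G_{ℚ_p}`, (D) `γ` preserves `Δ^tp_{X̲̲}` and (E) the automorphism `pr₁ ∘ γ|_{Δ^tp_{X̲̲}}` of the dense subgroup `pr₁(dUU l)` of the open
subgroup `Û := ĥ_l⁻¹{x = z = 0} ≤ F̂₂` (index `l²`) is the restriction of a topological automorphism of the free profinite group `F̂₂`.
Refuter targets are therefore (D)-violators or automorphisms of `Û` compatible with a `γ` but not extendable to `F̂₂`; the instruments of
record (R5-1 p496682/p497023, (K1) p496371, R5-2, XTHETA-KER) all live on the (E) side.  Neither direction of `hextΔ` is claimed.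

HONEST LABEL. `modelχq` is a SEMI-SYNTHETIC model of the typed [EtTh] §1 interface (not the tempered `π₁` of a curve): statements about
OUR model and OUR typed binder only; nothing of [EtTh] / [IUTchII] (claim key `Mochizuki2012`, DISPUTED, D-0012) is asserted; no side is
taken on [IUTchIII] Cor. 3.12; typed ≠ proved; nothing here bears on whether abc is proved or refuted.
bears_on: LADDER-ABC:A2.L-K (K-L6 «HEXT-DECIDE@modelχq») → LADDER-FRONTIER F-A2 (M·L6) → rung 0 `Summit.ABC`.
-/

set_option autoImplicit false

noncomputable section

namespace Literature.AnabelianGeometry.EtaleTheta.SettingModel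

open Literature.AnabelianGeometry.SemiGraphs
open Literature.IUT.HodgeArakelov Literature.IUT.HodgeArakelov.EtaleThetaDataOfSetting
open Function
open _root_.Topology

/-! ## §1. Degree bookkeeping is automatic: endomorphisms of `F̂₂` respecting `pr₁(dUU l) → pr₁(Γ)` lift to `Γ` -/

/-- `Ẑ` is commutative (componentwise in the finite quotients `ℤ/N`). [cite: RibesZalesskii2010, Thm 2.7.1] -/
private theorem zh_commute (a b : ZH) : Commute a b := by
  change a * b = b * a
  apply Subtype.ext
  funext N
  change a.val N * b.val N = b.val N * a.val N
  have key : ∀ u v : Multiplicative ℤ ⧸ N.toSubgroup, u * v = v * u := fun u v => _root_.mul_comm u v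
  exact key (a.val N) (b.val N)

/-- **`ê(Ψ(pr₁ g)) ∈ ι(ℤ)` for every `g ∈ Γ`**, as soon as the endomorphism `Ψ` of `F̂₂` maps `pr₁(dUU l)` into `pr₁(Γ)`: with `M` the
index of the normal core `Ker ĥ_l ≤ dUU l`, `g^M ∈ dUU l`, so `ê(Ψ(pr₁ g))^M = ι(k)`; level `M` gives `M ∣ k`, and `Ẑ` is torsion-free
(the tree's `zh_eq_one_of_pow_eq_one`).
[cite: MochizukiEtTh2009, §1 p.12] -/
theorem exists_eHat_apply_gfpFst_eq_iotaZ (l' : ℕ+) (Ψ : F₂hatT →* F₂hatT)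
    (hΨ : ∀ d ∈ dUU l', ∃ d' : Gfp, Ψ (gfpFst d) = gfpFst d') (g : Gfp) :
    ∃ n : Multiplicative ℤ, eHat (Ψ (gfpFst g)) = iotaZ n := by
  -- the index `M` of the normal core `Ker ĥ_l ≤ dUU l`
  haveI : NeZero (l' : ℕ) := ⟨PNat.ne_zero l'⟩
  have hM0 : (levelHom l').ker.index ≠ 0 := by rw [Subgroup.index_ker]; exact Nat.card_pos.ne'
  let M : ℕ+ := ⟨(levelHom l').ker.index, Nat.pos_of_ne_zero hM0⟩
  have hMval : (M : ℕ) = (levelHom l').ker.index := rfl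
  have hgM : g ^ (M : ℕ) ∈ dUU l' := by
    have hk : g ^ (M : ℕ) ∈ (levelHom l').ker := by rw [hMval]; exact Subgroup.pow_index_mem _ g
    rw [MonoidHom.mem_ker] at hk
    exact (mem_dUU_iff l' _).2 ⟨by rw [hk]; exact Heis.one_x, by rw [hk]; exact Heis.one_z⟩
  obtain ⟨d', hd'⟩ := hΨ _ hgM
  -- `y^M = ι(deg d')`
  have hyM : (eHat (Ψ (gfpFst g))) ^ (M : ℕ) = iotaZ ((d' : F₂hatT × Multiplicative ℤ).2) := by
    rw [← map_pow, ← map_pow, ← map_pow, hd', gfpFst_apply]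
    exact (mem_Gfp _).1 d'.2
  -- `M ∣ deg d'`
  have hKM : ((M : ℕ) : ℤ) ∣ Multiplicative.toAdd ((d' : F₂hatT × Multiplicative ℤ).2) := by
    have h1 := congrArg (fun t => Multiplicative.toAdd (modN M t)) hyM
    simp only [map_pow, toAdd_pow, nsmul_eq_mul, ZMod.natCast_self, zero_mul, modN_iotaZ, toAdd_ofAdd] at h1
    exact (ZMod.intCast_zmod_eq_zero_iff_dvd _ M).1 h1.symm
  obtain ⟨K', hK'⟩ := hKM
  refine ⟨Multiplicative.ofAdd K', ?_⟩
  -- `y^M = ι(K')^M`, hence `y = ι(K')` by torsion-freeness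
  have hz : (eHat (Ψ (gfpFst g))) ^ (M : ℕ) = (iotaZ (Multiplicative.ofAdd K')) ^ (M : ℕ) := by
    rw [hyM, ← map_pow, ← ofAdd_nsmul, nsmul_eq_mul, ← hK', ofAdd_toAdd]
  have hcomm : Commute (eHat (Ψ (gfpFst g))) (iotaZ (Multiplicative.ofAdd K'))⁻¹ := (zh_commute _ _).inv_right
  have h1 : (eHat (Ψ (gfpFst g)) * (iotaZ (Multiplicative.ofAdd K'))⁻¹) ^ (M : ℕ) = 1 := by
    rw [hcomm.mul_pow, inv_pow, hz, mul_inv_cancel]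
  exact mul_inv_eq_one.1 (zh_eq_one_of_pow_eq_one (PNat.ne_zero M) h1)

/-- **Lifting to `Γ`.** An endomorphism `Ψ` of `F̂₂` mapping `pr₁(dUU l)` into `pr₁(Γ)` lifts along the injective `pr₁ : Γ → F̂₂` to an
endomorphism `Φ₀` of `Γ` with `pr₁ ∘ Φ₀ = Ψ ∘ pr₁`. [cite: MochizukiEtTh2009, §1 p.12] -/
theorem exists_monoidHom_gfpFst_comp (l' : ℕ+) (Ψ : F₂hatT →* F₂hatT)
    (hΨ : ∀ d ∈ dUU l', ∃ d' : Gfp, Ψ (gfpFst d) = gfpFst d') :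
    ∃ Φ₀ : Gfp →* Gfp, ∀ g : Gfp, gfpFst (Φ₀ g) = Ψ (gfpFst g) := by
  classical
  choose n hn using exists_eHat_apply_gfpFst_eq_iotaZ l' Ψ hΨ
  let f : Gfp → Gfp := fun g => ⟨(Ψ (gfpFst g), n g), (mem_Gfp _).2 (hn g)⟩
  have hf : ∀ g, gfpFst (f g) = Ψ (gfpFst g) := fun _ => rfl
  refine ⟨MonoidHom.mk' f fun a b => gfpFst_injective ?_, hf⟩
  rw [map_mul gfpFst, hf, hf, hf, map_mul gfpFst, map_mul Ψ]

variable {p : ℕ} [Fact p.Prime] {i j : ℤ} {hj : Even j} {E : (ThetaSetting.modelχq p i j hj).EtaleThetaData} {l : ℕ}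
  (C : E.DoubleUnderline l) {l' : ℕ+}
  (hinl : ∀ d ∈ dUU l', (SemidirectProduct.inl d : PiTpχq p i j) ∈ C.Huu)
  (hinr : ∀ σ : GQp p, (SemidirectProduct.inr σ : PiTpχq p i j) ∈ C.Huu)
  (hleft : ∀ h ∈ C.Huu, (h : PiTpχq p i j).left ∈ dUU l')

/-! ## §2. The F̂₂ form of `hextΔ(γ)` -/

include hinl hinr hleft in
/-- ★ **`hextΔ(γ)` ⟺ [`γ` CARRIES `Δ^tp_{X̲̲}` ONTO ITSELF] ∧ [THE COMPLETED GEOMETRIC PART EXTENDS TO `Aut_top(F̂₂)`].**  At an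
`X̲̲`-choice with `Π^tp_{X̲̲} = dUU l ⋊ G_{ℚ_p}` over the stage-2 Tate model (`Δ^tp_X = Γ = F̂₂ ×_Ẑ ℤ`, `pr₁ : Γ → F̂₂` the profinite
completion), a bi-continuous automorphism `γ` of `Π^tp_{X̲̲}` extends to a `Δ^tp_X`-stabilising bi-continuous automorphism of `Π^tp_X`
IF AND ONLY IF (D) `(γ (inl d)).right = 1` and `(γ⁻¹ (inl d)).right = 1` for all `d ∈ dUU l` (displayed conjunct, not a tree theorem)
AND (E) some topological automorphism `Φ̂` of the free profinite group `F̂₂` satisfies `Φ̂ (pr₁ d) = pr₁ ((γ (inl d)).left)` for all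
`d ∈ dUU l`.  Neither direction of `hextΔ` is claimed. [cite: MochizukiEtTh2009, Prop 2.4 p.38] -/
theorem hext_at_iff_exists_f2hatAut (γ : ↥C.Huu ≃ₜ* ↥C.Huu) :
    (∃ Γ : PiTpχq p i j ≃ₜ* PiTpχq p i j,
      (∀ h : C.Huu, Γ (h : PiTpχq p i j) = ((γ h : C.Huu) : PiTpχq p i j)) ∧
        (curveχq p i j).DeltaTemp.map Γ.toMulEquiv.toMonoidHom = (curveχq p i j).DeltaTemp) ↔
    ((∀ (d : Gfp) (hd : d ∈ dUU l'), (((γ ⟨SemidirectProduct.inl d, hinl d hd⟩ : C.Huu) : PiTpχq p i j)).right = 1) ∧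
      (∀ (d : Gfp) (hd : d ∈ dUU l'), (((γ.symm ⟨SemidirectProduct.inl d, hinl d hd⟩ : C.Huu) : PiTpχq p i j)).right = 1) ∧
      ∃ Φh : F₂hatT ≃ₜ* F₂hatT, ∀ (d : Gfp) (hd : d ∈ dUU l'),
        Φh (gfpFst d) = gfpFst (((γ ⟨SemidirectProduct.inl d, hinl d hd⟩ : C.Huu) : PiTpχq p i j)).left) := by
  constructor
  · intro hγ
    obtain ⟨Φ, hU, hi, -⟩ := exists_gfpAut_of_hext_at C hinl hinr hleft γ hγ
    refine ⟨fun d hd => ?_, fun d hd => ?_, ?_⟩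
    · rw [← hi d hd, SemidirectProduct.right_inl]
    · -- `Φ⁻¹ d ∈ dUU l` and `γ (inl (Φ⁻¹ d)) = inl d`
      have hmem : Φ.symm d ∈ dUU l' := by
        have hd' : d ∈ (dUU l').map Φ.toMulEquiv.toMonoidHom := by rw [hU]; exact hd
        obtain ⟨d₀, hd₀, hd₀d⟩ := hd'
        have h0 : Φ.symm d = d₀ := by
          rw [← hd₀d]
          exact Φ.symm_apply_apply d₀
        rw [h0]
        exact hd₀
      have key : γ ⟨SemidirectProduct.inl (Φ.symm d), hinl _ hmem⟩ = ⟨SemidirectProduct.inl d, hinl d hd⟩ :=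
        Subtype.ext (by rw [← hi _ hmem, Φ.apply_symm_apply])
      rw [← key, γ.symm_apply_apply, SemidirectProduct.right_inl]
    · obtain ⟨e, he⟩ := isProfiniteCompletion_gfpFst.exists_continuousMulEquiv_extending Φ
      refine ⟨e, fun d hd => ?_⟩
      rw [he]
      have h1 := congrArg SemidirectProduct.left (hi d hd)
      rw [SemidirectProduct.left_inl] at h1
      rw [h1]
  · rintro ⟨hp, hm, Φh, hΦh⟩
    -- the geometric parts of `γ`, `γ⁻¹` are `inl`-valued
    have hinlp : ∀ (d : Gfp) (hd : d ∈ dUU l'),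
        ((γ ⟨SemidirectProduct.inl d, hinl d hd⟩ : C.Huu) : PiTpχq p i j) =
          SemidirectProduct.inl (((γ ⟨SemidirectProduct.inl d, hinl d hd⟩ : C.Huu) : PiTpχq p i j)).left := fun d hd =>
      SemidirectProduct.ext (by rw [SemidirectProduct.left_inl]) (by rw [SemidirectProduct.right_inl, hp d hd])
    have hinlm : ∀ (d : Gfp) (hd : d ∈ dUU l'),
        ((γ.symm ⟨SemidirectProduct.inl d, hinl d hd⟩ : C.Huu) : PiTpχq p i j) =
          SemidirectProduct.inl (((γ.symm ⟨SemidirectProduct.inl d, hinl d hd⟩ : C.Huu) : PiTpχq p i j)).left := fun d hd =>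
      SemidirectProduct.ext (by rw [SemidirectProduct.left_inl]) (by rw [SemidirectProduct.right_inl, hm d hd])
    have hmemm : ∀ (d : Gfp) (hd : d ∈ dUU l'),
        (((γ.symm ⟨SemidirectProduct.inl d, hinl d hd⟩ : C.Huu) : PiTpχq p i j)).left ∈ dUU l' :=
      fun d hd => hleft _ (γ.symm _).2
    -- `Φ̂⁻¹` agrees with the geometric part of `γ⁻¹` on `pr₁(dUU l)`
    have hΦh' : ∀ (d : Gfp) (hd : d ∈ dUU l'),
        Φh.symm (gfpFst d) = gfpFst (((γ.symm ⟨SemidirectProduct.inl d, hinl d hd⟩ : C.Huu) : PiTpχq p i j)).left := by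
      intro d hd
      apply Φh.injective
      rw [Φh.apply_symm_apply, hΦh _ (hmemm d hd)]
      have key : (⟨SemidirectProduct.inl (((γ.symm ⟨SemidirectProduct.inl d, hinl d hd⟩ : C.Huu) : PiTpχq p i j)).left,
          hinl _ (hmemm d hd)⟩ : C.Huu) = γ.symm ⟨SemidirectProduct.inl d, hinl d hd⟩ := Subtype.ext (hinlm d hd).symm
      rw [key, γ.apply_symm_apply]
      rfl
    -- lift `Φ̂`, `Φ̂⁻¹` to endomorphisms of `Γ`
    obtain ⟨Φ₀, hΦ₀⟩ := exists_monoidHom_gfpFst_comp l' Φh.toMulEquiv.toMonoidHom fun d hd => ⟨_, hΦh d hd⟩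
    obtain ⟨Ψ₀, hΨ₀⟩ := exists_monoidHom_gfpFst_comp l' Φh.symm.toMulEquiv.toMonoidHom fun d hd => ⟨_, hΦh' d hd⟩
    have h1 : ∀ g, Ψ₀ (Φ₀ g) = g := fun g => gfpFst_injective (by
      rw [hΨ₀, hΦ₀]
      exact Φh.symm_apply_apply _)
    have h2 : ∀ g, Φ₀ (Ψ₀ g) = g := fun g => gfpFst_injective (by
      rw [hΦ₀, hΨ₀]
      exact Φh.apply_symm_apply _)
    -- on `dUU l` they ARE the geometric parts
    have hΦ₀d : ∀ (d : Gfp) (hd : d ∈ dUU l'),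
        Φ₀ d = (((γ ⟨SemidirectProduct.inl d, hinl d hd⟩ : C.Huu) : PiTpχq p i j)).left := fun d hd =>
      gfpFst_injective (by rw [hΦ₀]; exact hΦh d hd)
    have hΨ₀d : ∀ (d : Gfp) (hd : d ∈ dUU l'),
        Ψ₀ d = (((γ.symm ⟨SemidirectProduct.inl d, hinl d hd⟩ : C.Huu) : PiTpχq p i j)).left := fun d hd =>
      gfpFst_injective (by rw [hΨ₀]; exact hΦh' d hd)
    -- continuity: a homomorphism agreeing with a continuous map on the open subgroup `dUU l ∋ 1`
    have hcl : Continuous fun x : PiTpχq p i j => x.left := Semidirect.continuous_left (isInducing_leftRightχq p i j)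
    have hΦ₀c : Continuous Φ₀ := by
      refine continuous_of_continuousAt_one Φ₀ ?_
      have hon : ContinuousOn Φ₀ (dUU l' : Set Gfp) := by
        rw [continuousOn_iff_continuous_restrict]
        have heq : (dUU l' : Set Gfp).restrict Φ₀ = fun x : (dUU l' : Set Gfp) =>
            (((γ ⟨SemidirectProduct.inl (x : Gfp), hinl (x : Gfp) x.2⟩ : C.Huu) : PiTpχq p i j)).left :=
          funext fun x => hΦ₀d (x : Gfp) x.2
        rw [heq]
        exact hcl.comp (continuous_subtype_val.comp (γ.continuous.comp
          (((continuous_inlχq p i j).comp continuous_subtype_val).subtype_mk _)))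
      exact hon.continuousAt ((isOpen_dUU l').mem_nhds (one_mem _))
    have hΨ₀c : Continuous Ψ₀ := by
      refine continuous_of_continuousAt_one Ψ₀ ?_
      have hon : ContinuousOn Ψ₀ (dUU l' : Set Gfp) := by
        rw [continuousOn_iff_continuous_restrict]
        have heq : (dUU l' : Set Gfp).restrict Ψ₀ = fun x : (dUU l' : Set Gfp) =>
            (((γ.symm ⟨SemidirectProduct.inl (x : Gfp), hinl (x : Gfp) x.2⟩ : C.Huu) : PiTpχq p i j)).left :=
          funext fun x => hΨ₀d (x : Gfp) x.2
        rw [heq]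
        exact hcl.comp (continuous_subtype_val.comp (γ.symm.continuous.comp
          (((continuous_inlχq p i j).comp continuous_subtype_val).subtype_mk _)))
      exact hon.continuousAt ((isOpen_dUU l').mem_nhds (one_mem _))
    -- the bi-continuous automorphism `Φ` of `Γ` extending the geometric part of `γ`
    let Φ : Gfp ≃ₜ* Gfp :=
      { toFun := Φ₀
        invFun := Ψ₀
        left_inv := h1
        right_inv := h2
        map_mul' := map_mul Φ₀
        continuous_toFun := hΦ₀c
        continuous_invFun := hΨ₀c }
    refine (hext_at_iff_exists_gfpAut_extends C hinl hinr hleft γ).2 ⟨Φ, fun d hd => ?_⟩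
    change SemidirectProduct.inl (Φ₀ d) = _
    rw [hΦ₀d d hd, ← hinlp d hd]

/-- **The F̂₂ form AT THE CARRIER OF RECORD** `Π^tp_{X̲̲} = Huuχq p i j l hl`: for every `X̲̲`-choice `C` over `modelχq p i j` with
`C.Huu = Huuχq p i j l hl`, `hextΔ(γ) ⟺ (D) ∧ (E)`. [cite: MochizukiEtTh2009, Prop 2.4 p.38] -/
theorem hext_at_iff_exists_f2hatAut_of_eq (l' : ℕ+) (hl' : Odd (l' : ℕ)) (hCH : C.Huu = Huuχq p i j l' hl')
    (γ : ↥C.Huu ≃ₜ* ↥C.Huu) :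
    (∃ Γ : PiTpχq p i j ≃ₜ* PiTpχq p i j,
      (∀ h : C.Huu, Γ (h : PiTpχq p i j) = ((γ h : C.Huu) : PiTpχq p i j)) ∧
        (curveχq p i j).DeltaTemp.map Γ.toMulEquiv.toMonoidHom = (curveχq p i j).DeltaTemp) ↔
    ((∀ (d : Gfp) (hd : d ∈ dUU l'),
        (((γ ⟨SemidirectProduct.inl d, hCH ▸ (inl_mem_Huuχq_iff p i j l' hl' d).2 hd⟩ : C.Huu) : PiTpχq p i j)).right = 1) ∧
      (∀ (d : Gfp) (hd : d ∈ dUU l'),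
        (((γ.symm ⟨SemidirectProduct.inl d, hCH ▸ (inl_mem_Huuχq_iff p i j l' hl' d).2 hd⟩ : C.Huu) : PiTpχq p i j)).right = 1) ∧
      ∃ Φh : F₂hatT ≃ₜ* F₂hatT, ∀ (d : Gfp) (hd : d ∈ dUU l'),
        Φh (gfpFst d) =
          gfpFst (((γ ⟨SemidirectProduct.inl d, hCH ▸ (inl_mem_Huuχq_iff p i j l' hl' d).2 hd⟩ : C.Huu) : PiTpχq p i j)).left) :=
  hext_at_iff_exists_f2hatAut C (fun d hd => hCH ▸ (inl_mem_Huuχq_iff p i j l' hl' d).2 hd)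
    (fun σ => hCH ▸ inr_mem_Huuχq p i j l' hl' σ)
    (fun h hh => ((mem_Huuχq_iff p i j l' hl' h).1 (hCH ▸ hh)).1 |> fun hx =>
      (mem_dUU_iff l' h.left).2 ⟨hx, ((mem_Huuχq_iff p i j l' hl' h).1 (hCH ▸ hh)).2⟩) γ

end Literature.AnabelianGeometry.EtaleTheta.SettingModel

end
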